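import Summits.BirchSwinnertonDyer.BirchSwinnertonDyer.Theorems.PrintX8SmallImageMuReading
import Summits.BirchSwinnertonDyer.BirchSwinnertonDyer.Theses.PrintX8
import Summits.BirchSwinnertonDyer.BirchSwinnertonDyer.Theorems.SignedLowerHalvesSprungLowerDivisibilityAtThreeSurjBranch
import HarnessLib

/-!
# Route `PrintX8`, crux `SharpFlatMainConjectureSmallImageX8` (stmt-BirchSwinnertonDyer-20402) — GLUE
# SHAPES for the planner's split/replacement of 20402 by the `μ`-bound: C1 `SharpFlatMainConjectureX8`
# ⟸ K1 + (`μ`-bound on the SMALL-IMAGE pairs only) + `PublishedInputsX8`, and the big-image remark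
# «given K1 the `μ`-equality is a THEOREM on surj(3)» (cell `bsd-print-x8`, D-0131 (2) print tier,
# prover seat p3; `--supports` 20402, closes nothing)

PARTITION (cell bsd-print-x8, leaf `ClassX8`; 156 surj(3) cells + 61 `N_ns(3)` cells): types-the-object-of
the glue; closes NONE; 0 census cells move; BSD is not proved by any of this.

HONEST FRAMING. Files A/B/C of this seat (p539576 `PrintX8SmallImageMuReading`, p540766
`PrintX8SmallImageMuSplit`, p541386 `PrintX8SmallImageRankZero`) proved: given K1, crux 20402 ⟺ the
`μ`-bound `MuBoundSmallImageX8` («`μ(X^•) ≤ μ(Λ/(L^•))` on the X8 pairs with `¬ Surj W 3` and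
`r_an ≤ 1`», the `hμ` binder below, verbatim as in file B). File B's image-free C1 theorem needs the
`μ`-bound on ALL X8 pairs; THIS file supplies the two remaining by-name shapes a route edit may want:
* `X8.muInvariant_eq_of_lowerDivisibility_of_surj` — at an X8 pair WITH `surj(3)`, K1's predicate
  already gives the `μ`-EQUALITY for every datum (Kato's `n = 0` under `GL₂(ℤ₃)`-surjectivity =
  Wuthrich 2014 Lemma 20, via p2's surj-branch theorem p534029, composed with file A's
  `X8.muInvariant_eq_of_sprungSharpFlatMainConjecture`): the `μ`-bound is a residual ONLY off surj(3);
* `sharpFlatMainConjectureX8_of_K1_of_muBoundSmallImage_of_publishedInputs` — **the route's glue item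
  `GlueMainConjectureX8` (stmt-20404, p2) with the `μ`-bound IN PLACE OF the small-image crux**:
  `SprungLowerDivisibilityAtThree → MuBoundSmallImageX8 → PublishedInputsX8 → SharpFlatMainConjectureX8`
  (surj: p534029; non-surj: file B), i.e. if the planner REPLACES 20402 by the `μ`-bound in `closes`,
  this is the new glue's proof term; if the planner SPLITS 20402 (keeping it in `closes`), file B's
  `sharpFlatMainConjectureSmallImageX8_of_sprungLowerDivisibilityAtThree_of_muBound` /
  `…_of_publishedInputs_of_K1_of_muBound` is the split glue. Either way a one-line closer.
Imports p2's surj-branch file (which imports the K3 route file `Theses/SignedLowerHalves.lean`; the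
two copies of K1 — `Theses.PrintX8.SprungLowerDivisibilityAtThree` and
`Theses.SignedLowerHalves.SprungLowerDivisibilityAtThree` — are the same term). Beyond-print theorem: NO.
PARTITION: 0 cells.

References: [Sprung2012] Thm. 7.14, 7.16, Main Conj. 7.21; [Wuthrich2014] Lemma 20; [Washington1997]
§13.2; files p534029, p539576, p540766, `Theses/PrintX8.lean` rev 6.
-/

set_option autoImplicit false
-- justification: the mandated namespace `Summit.BirchSwinnertonDyer.BirchSwinnertonDyer.Theorems`
-- (single-conjunct summit, Sub = Summit) repeats a segment by design (D-0017).
set_option linter.dupNamespace false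

noncomputable section

open scoped Classical NumberField MatrixGroups ModularForm
open NumberField IsDedekindDomain WeierstrassCurve CongruenceSubgroup
  Literature.NumberTheory.EllipticCurves Literature.NumberTheory.EllipticCurves.ModularForms
  Literature.NumberTheory.EllipticCurves.Rank1Residual
  Literature.NumberTheory.EllipticCurves.Sprung2017 Literature.NumberTheory.EllipticCurves.Sprung2012
  Literature.NumberTheory.EllipticCurves.ZpExtension
  Summit.BirchSwinnertonDyer.BirchSwinnertonDyer.Theorems
  Summit.BirchSwinnertonDyer.BirchSwinnertonDyer.Theorems.PrintX8MuReading

namespace Summit.BirchSwinnertonDyer.BirchSwinnertonDyer.Theorems.PrintX8MuGlue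

open Summit.BirchSwinnertonDyer Summit.BirchSwinnertonDyer.Rank1Residual.Supersingular
  Literature.NumberTheory.EllipticCurves.BurungaleTian2026

/-! ### §1. Big image: the `μ`-equality is a theorem given K1 -/

/-- **On the big-image branch the `μ`-equality is a THEOREM given K1** (Kato's `n = 0` under
`GL₂(ℤ₃)`-surjectivity = Wuthrich 2014 Lemma 20 at the good supersingular prime `3`, via the surj-branch
file p534029): at an X8 pair with `surj(3)`, K1's predicate ⇒ `μ(X^•) = μ(Λ/(L^•))` for every datum. So
the `μ`-bound is a residual ONLY on the 61 `N_ns(3)` cells. PER PAIR; conditional on K1's predicate.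
[cite: Sprung2012, Thm. 7.14, Thm. 7.16 (p. 1504) and Main Conj. 7.21 (p. 1505)] [cite: Wuthrich2014, Lemma 20 (p. 399)] -/
theorem X8.muInvariant_eq_of_lowerDivisibility_of_surj
    (h714 : thm714_sharpFlatSelmerDual_finite_torsion)
    (h716 : thm716_sharpFlatCharIdeal_divisibility)
    (h3 : realPeriodRat_eq_unit_mul_plusPeriod_three)
    (W : WeierstrassCurve ℚ) [W.IsElliptic] [W.IsGloballyMinimal] (p : ℕ) [Fact p.Prime]
    (hX : ClassX8 W p) (hs : Surj W p) (col : Chroma) (hK1 : SprungSharpFlatLowerDivisibility W p col) :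
    ∀ (κ : ZpExtension ℚ p) (γ : Field.absoluteGaloisGroup ℚ),
        κ.IsCyclotomic → κ.IsTopGenerator γ → IsCyclotomicVariable p γ →
      ∀ (v : HeightOneSpectrum (𝓞 ℚ)), (p : 𝓞 ℚ) ∈ v.asIdeal →
      ∀ (g : Field.absoluteGaloisGroup (v.adicCompletion ℚ)),
        κ.IsTopGenerator (resGalOfEmb (closureEmb (K := ℚ) (v.adicCompletion ℚ)) g) →
      ∀ (cneg : localPoints W (v.adicCompletion ℚ)) (c : ℕ → localPoints W (v.adicCompletion ℚ)),
        IsHondaSystem κ (closureEmb (K := ℚ) (v.adicCompletion ℚ)) W (W.frobeniusTrace p) g cneg c →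
      ∀ (N : ℕ) (_ : NeZero N) (f : CuspForm (Gamma0 N) 2) (Lsharp Lflat : IwasawaAlgebra p),
        IsNewformOf W f → IsSprungPair f p (W.frobeniusTrace p) Lsharp Lflat →
        chromaticL col Lsharp Lflat ≠ 0 →
      ∀ D : SharpFlatSelmerDualData W κ γ (closureEmb (K := ℚ) (v.adicCompletion ℚ))
          (W.frobeniusTrace p) g c col,
        muInvariant p D.X = muInvariant p (IwasawaAlgebra p ⧸ Ideal.span {chromaticL col Lsharp Lflat}) :=
  X8.muInvariant_eq_of_sprungSharpFlatMainConjecture h714 h3 W p hX col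
    (X8.sprungSharpFlatMainConjecture_of_lowerDivisibility_of_surj h714 h716 h3 W p hX hs col hK1)


/-! ### §2. Glue shapes over the route's decls -/

/-- **The route's glue `GlueMainConjectureX8` (stmt-20404) with the `μ`-bound in place of the
small-image crux**: K1 (`Theses.PrintX8.SprungLowerDivisibilityAtThree`, item 19875) → (`μ`-bound on
the small-image X8 pairs of rank `≤ 1`) → `PublishedInputsX8` (conjuncts 4, 5, 7: Sprung 2012 Thms.
7.14 / 7.16, period unit at `3`) → C1 `SharpFlatMainConjectureX8`. Big image: p2's surj-branch theorem
(p534029; Kato `n = 0` by Wuthrich 2014 Lemma 20); small image: file B's `μ`-criterion. CONDITIONAL;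
closes nothing (20404 itself is closed by p2 over 20402). [cite: Sprung2012, Thm. 7.14, Thm. 7.16 (p. 1504) and Main Conj. 7.21 (p. 1505)]
[cite: Wuthrich2014, Lemma 20 (p. 399)] -/
theorem sharpFlatMainConjectureX8_of_K1_of_muBoundSmallImage_of_publishedInputs
    (hK1 : Theses.PrintX8.SprungLowerDivisibilityAtThree)
    (hμ : ∀ (W : WeierstrassCurve ℚ) [W.IsElliptic] [W.IsGloballyMinimal] (p : ℕ) [Fact p.Prime],
        ClassX8 W p → ¬ Surj W p → W.analyticRank ≤ 1 → ∀ col : Chroma,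
        ∀ (κ : ZpExtension ℚ p) (γ : Field.absoluteGaloisGroup ℚ),
            κ.IsCyclotomic → κ.IsTopGenerator γ → IsCyclotomicVariable p γ →
          ∀ (v : HeightOneSpectrum (𝓞 ℚ)), (p : 𝓞 ℚ) ∈ v.asIdeal →
          ∀ (g : Field.absoluteGaloisGroup (v.adicCompletion ℚ)),
            κ.IsTopGenerator (resGalOfEmb (closureEmb (K := ℚ) (v.adicCompletion ℚ)) g) →
          ∀ (cneg : localPoints W (v.adicCompletion ℚ)) (c : ℕ → localPoints W (v.adicCompletion ℚ)),
            IsHondaSystem κ (closureEmb (K := ℚ) (v.adicCompletion ℚ)) W (W.frobeniusTrace p) g cneg c →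
          ∀ (N : ℕ) (_ : NeZero N) (f : CuspForm (Gamma0 N) 2) (Lsharp Lflat : IwasawaAlgebra p),
            IsNewformOf W f → IsSprungPair f p (W.frobeniusTrace p) Lsharp Lflat →
            chromaticL col Lsharp Lflat ≠ 0 →
          ∀ D : SharpFlatSelmerDualData W κ γ (closureEmb (K := ℚ) (v.adicCompletion ℚ))
              (W.frobeniusTrace p) g c col,
            muInvariant p D.X ≤ muInvariant p (IwasawaAlgebra p ⧸ Ideal.span {chromaticL col Lsharp Lflat}))
    (hPub : Theses.PrintX8.PublishedInputsX8) : Theses.PrintX8.SharpFlatMainConjectureX8 := by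
  obtain ⟨-, -, -, h714, h716, -, h3, -⟩ := hPub
  intro W _ _ p _ hX hr col
  by_cases hs : Surj W p
  · exact X8.sprungSharpFlatMainConjecture_of_lowerDivisibility_of_surj h714 h716 h3 W p hX hs col
      (hK1 W p hX col)
  · exact X8.sprungSharpFlatMainConjecture_of_lowerDivisibility_of_muInvariant_le h714 h716 h3 W p hX
      col (hK1 W p hX col) (hμ W p hX hs hr col)

/-- **Hence, modulo `PublishedInputsX8` and K1, C1 (stmt-20304) ⟺ the `μ`-bound on the small-image
pairs** (⇒: C1 gives 20402 on the small-image pairs, then file B's converse). READING for the route's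
tribunal: after the split, the cone's only open content beyond the 8 held facts is {K1, `μ`-bound}.
[cite: Sprung2012, Main Conj. 7.21 (p. 1505)] [cite: Washington1997, §13.2] -/
theorem sharpFlatMainConjectureX8_iff_muBoundSmallImage_of_K1_of_publishedInputs
    (hK1 : Theses.PrintX8.SprungLowerDivisibilityAtThree) (hPub : Theses.PrintX8.PublishedInputsX8) :
    Theses.PrintX8.SharpFlatMainConjectureX8 ↔
      (∀ (W : WeierstrassCurve ℚ) [W.IsElliptic] [W.IsGloballyMinimal] (p : ℕ) [Fact p.Prime],
        ClassX8 W p → ¬ Surj W p → W.analyticRank ≤ 1 → ∀ col : Chroma,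
        ∀ (κ : ZpExtension ℚ p) (γ : Field.absoluteGaloisGroup ℚ),
            κ.IsCyclotomic → κ.IsTopGenerator γ → IsCyclotomicVariable p γ →
          ∀ (v : HeightOneSpectrum (𝓞 ℚ)), (p : 𝓞 ℚ) ∈ v.asIdeal →
          ∀ (g : Field.absoluteGaloisGroup (v.adicCompletion ℚ)),
            κ.IsTopGenerator (resGalOfEmb (closureEmb (K := ℚ) (v.adicCompletion ℚ)) g) →
          ∀ (cneg : localPoints W (v.adicCompletion ℚ)) (c : ℕ → localPoints W (v.adicCompletion ℚ)),
            IsHondaSystem κ (closureEmb (K := ℚ) (v.adicCompletion ℚ)) W (W.frobeniusTrace p) g cneg c →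
          ∀ (N : ℕ) (_ : NeZero N) (f : CuspForm (Gamma0 N) 2) (Lsharp Lflat : IwasawaAlgebra p),
            IsNewformOf W f → IsSprungPair f p (W.frobeniusTrace p) Lsharp Lflat →
            chromaticL col Lsharp Lflat ≠ 0 →
          ∀ D : SharpFlatSelmerDualData W κ γ (closureEmb (K := ℚ) (v.adicCompletion ℚ))
              (W.frobeniusTrace p) g c col,
            muInvariant p D.X ≤
              muInvariant p (IwasawaAlgebra p ⧸ Ideal.span {chromaticL col Lsharp Lflat})) := by
  refine ⟨fun hC1 ↦ ?_,
    fun hμ ↦ sharpFlatMainConjectureX8_of_K1_of_muBoundSmallImage_of_publishedInputs hK1 hμ hPub⟩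
  obtain ⟨-, -, -, h714, -, -, h3, -⟩ := hPub
  intro W _ _ p _ hX hns hr col κ γ hκ hγ hγ' v hv g hg cneg c hc N hN f Lsharp Lflat hf hSP hcol D
  exact (X8.muInvariant_eq_of_sprungSharpFlatMainConjecture h714 h3 W p hX col (hC1 W p hX hr col) κ γ
    hκ hγ hγ' v hv g hg cneg c hc N hN f Lsharp Lflat hf hSP hcol D).le

end Summit.BirchSwinnertonDyer.BirchSwinnertonDyer.Theorems.PrintX8MuGlue

end
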